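import Summits.Schanuel.Schanuel.Theorems.RootDecomp1KLevelFinite07

/-!
# RootDecomp1KLevelFinite — lens 1, generation 51 ADDENDUM «BOTH SPLIT CONJUGATE-POLES LEAVES CLOSED: normShapeLF_holds» (§8 SplitGrades) — continuation (RootDecomp1KLevelFinite08): §8.6 one level: height, arithmetic, 2-adic closeness

(lens-1 g51 ADDENDUM kernel K″ = HOME/decomp-schanuel-lens-1/g51/LevelFiniteSplit.lean 375ea065…, 2255 l = node-10 K b1fbaeff… VERBATIM (843/843 lines in order; ported as RootDecomp1KLevelFinite01–04) + TWO pure insertions: an addendum module docstring and `§8 section SplitGrades` (K″ l.863–2252, 75 decls); same single import …RootDecomp1KXLinear05; P″ LevelFiniteSplitProbe.lean rc 0 / C₀″ rc 0 / C″ LevelFiniteSplitCtrl.lean rc 1 = 10 planted; ADDENDUM/NODE L2486 / REQUEST L2487, critic VERDICT L2488: CLEARED under RULE K-R40 (ii)/(v) — ONE THEOREM ×1 «CONJUGATE-POLES LEAVES CLOSED: (NormShapeLevels g q a D).Finite for EVERY NormShapeHyp g q a D, uniformly over all grades, by a two-pass 2-adic Ridout argument in PadicAlgCl 2 on the tree's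 `RootDecomp1KXLinearCore.ridout_step`»; writer re-check L2489; PORT GO. Port by census-1 gen 21 of §8 as `RootDecomp1KLevelFinite05–09` continuing the 01–04 chain: 05 = §8.0 norms of integers in `PadicAlgCl 2`, binary forms `hform`, + §8.1 Bezout identities (`cpoly`, `bezout_forms`); 06 = §8.2 resultant data of a conjugate-poles shape + §8.3 the monicised quadratic in 𝕂 (`two_roots`, `ghatc`); 07 = §8.4 one level: integer bookkeeping (`psNumer_le`, `hform_two_eq`, …) + §8.5 the 𝕂-side (`nearest_root`, root extraction, `lamq`); 08 = §8.6 one level: height, arithmetic and the 2-adic closeness (`heightC`, `level_arith`, `level_padic`); 09 = §8.7 assembly **`normShapeLF_holds`** + §8.8 corollaries `normShapeLFSplitImag_holds` / `normShapeLFSplitReal_holds` (the two K binders LITERALLY), `levelFinite_of_siegelShapes''` / `thinFibre_of_siegelShapes''` / `b_of_siegelShapes''` (⟸ `SiegelShapes` ALONE) + §8.9 hyp-free instances `normShapeCurve`, `levelFinite_normShapeCurve`, `levelFinite_sqrt17_curve` (g47's residual (δ) family member DECIDED). PORT EDITS (census convention, pre-sanctioned L2488): `psNumer_pos'` privatised (homonym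 statement of private tree `psNumer_pos`); `isCoprime_num_den` stays private (privatised in 03; private copies where §8 calls it); 24 one-line helper docstrings (statements quoted); `section SplitGrades` with its two `open … (…)` lines closed / re-opened per part, the `open … (bev_map_C)` of §8.9 travels inside 09; statements and proofs otherwise verbatim, no renames, no heartbeat lines. `--supports stmt-Schanuel-33364`; no census credit carried; rung 0 — nothing here proves Schanuel, 33364, 31077, 33363, SiegelShapes, or ThinFibre m₀ / (b) hypothesis-free.)
-/

noncomputable section

open Polynomial LiouvilleNumber
open scoped Nat

namespace Summit.Schanuel.Schanuel.Theorems.RootDecomp1KLevelFinite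

open Summit.Schanuel.Schanuel.Theorems.RootDecomp1KSkelCell (iota SkelLiouville SkelLiouvilleFix
  skelLiouville_iff_fix SkelLiouvilleFix.mono)
open Summit.Schanuel.Schanuel.Theorems.RootDecomp1KTwoBaseCell (psNumer partialSum_eq_psNumer_div coprime_psNumer
  sb_of_range_eq')
open Summit.Schanuel.Schanuel.Theorems.RootDecomp1KRelLiouvilleCell (partialSum_two_strictMono)
open Summit.Schanuel.Schanuel.Theorems.RootDecomp1KDegreeLadder
open Summit.Schanuel.Schanuel.Theorems.RootDecomp1KXLinear (xLinP bev_xLinP aeval_ratCast levels_finite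
  thinFibreAt_mul_left)
open Summit.Schanuel.Schanuel.Theorems.RootDecomp1KHyper (SB SFset sb_of_algebraicIndependent)

/-- Numerator and denominator of a rational are coprime integers. -/
private theorem isCoprime_num_den (t : ℚ) : IsCoprime t.num (t.den : ℤ) := by
  rw [Int.isCoprime_iff_gcd_eq_one, Int.gcd_eq_natAbs, Int.natAbs_natCast]
  exact t.reduced

section SplitGrades

open Summit.Schanuel.Schanuel.Theorems.RootDecomp1KXLinearCore (roots_structure ridout_step)
open Summit.Schanuel.Schanuel.Theorems.RootDecomp1KXLinear (norm_psNumer_sub_one)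

/-! ### §8.6 One level: height, arithmetic, and the `2`-adic closeness -/

/-- [auxiliary] `λ_q = 2(|q₁| + |q₀|) + 2`, the slope threshold between the two charts. -/
noncomputable def lamq (q : ℤ[X]) : ℝ := 2 * (|(q.coeff 1 : ℝ)| + |(q.coeff 0 : ℝ)|) + 2

/-- `(q : ℤ[X]) : 1 ≤ lamq q`. -/
theorem one_le_lamq (q : ℤ[X]) : 1 ≤ lamq q := by
  unfold lamq; have := abs_nonneg (q.coeff 1 : ℝ); have := abs_nonneg (q.coeff 0 : ℝ); linarith

/-- [auxiliary] the height constant `C_h(q, Cb, K, D)`. -/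
noncomputable def heightC (q : ℤ[X]) (Cb : ℝ) (K : ℕ) (D : ℤ) : ℝ :=
  max 2 (lamq q ^ 2 * max 1 (Cb * lamq q ^ K * (2 * |(D : ℝ)| + 1)))

/-- `(q : ℤ[X]) (Cb : ℝ) (K : ℕ) (D : ℤ) : 1 ≤ heightC q Cb K D`. -/
theorem one_le_heightC (q : ℤ[X]) (Cb : ℝ) (K : ℕ) (D : ℤ) : 1 ≤ heightC q Cb K D :=
  le_trans (by norm_num) (le_max_left _ _)

/-- **Level height.**  `H(u,v)² ≤ C_h · |Q(u,v)|` from the `v`-chart Bezout identity and `|G| ≤ 2|D||Q|^a`. -/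
theorem level_height {g q : ℤ[X]} {a : ℕ} {D : ℤ} (hq : q.natDegree = 2) (ha : 1 ≤ a)
    {d₁ : ℤ} {K : ℕ} {Cb : ℝ} (hCb : 0 < Cb) (hKa : 2 * a ≤ K) (hK2 : 2 ≤ K) (hd₁ : d₁ ≠ 0)
    {u v A B : ℤ} (hv : v ≠ 0)
    (hid : A * hform g.coeff (2 * a) u v + B * hform q.coeff 2 u v = d₁ * v ^ K)
    (hA : |(A : ℝ)| ≤ Cb * (max |(u : ℝ)| |(v : ℝ)|) ^ (K - 2 * a))
    (hB : |(B : ℝ)| ≤ Cb * (max |(u : ℝ)| |(v : ℝ)|) ^ (K - 2))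
    (hQ0 : hform q.coeff 2 u v ≠ 0)
    (hGQ : |((hform g.coeff (2 * a) u v : ℤ) : ℝ)| ≤ 2 * |(D : ℝ)| * |((hform q.coeff 2 u v : ℤ) : ℝ)| ^ a) :
    (max |(u : ℝ)| |(v : ℝ)|) ^ 2 ≤ heightC q Cb K D * |((hform q.coeff 2 u v : ℤ) : ℝ)| := by
  have hlam := one_le_lamq q
  have hQ1 : (1 : ℝ) ≤ |((hform q.coeff 2 u v : ℤ) : ℝ)| := by
    rw [← Int.cast_abs]; exact_mod_cast Int.one_le_abs hQ0
  by_cases hcase : lamq q * |(v : ℝ)| ≤ |(u : ℝ)|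
  · -- `u`-dominant chart
    have hvu : |(v : ℝ)| ≤ |(u : ℝ)| := by nlinarith [abs_nonneg (v : ℝ)]
    rw [max_eq_left hvu]
    have := sq_le_of_uchart hq u v hcase
    calc |(u : ℝ)| ^ 2 ≤ 2 * |((hform q.coeff 2 u v : ℤ) : ℝ)| := this
      _ ≤ heightC q Cb K D * |((hform q.coeff 2 u v : ℤ) : ℝ)| := by
          gcongr; exact le_max_left _ _
  · -- `v`-dominant chart
    have hlt : |(u : ℝ)| < lamq q * |(v : ℝ)| := lt_of_not_ge hcase
    have hH : max |(u : ℝ)| |(v : ℝ)| ≤ lamq q * |(v : ℝ)| :=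
      max_le hlt.le (le_mul_of_one_le_left (abs_nonneg _) hlam)
    have hv2 := sq_le_of_vchart (G := hform g.coeff (2 * a) u v) (Q := hform q.coeff 2 u v) hCb
      (by positivity : (0 : ℝ) ≤ 2 * |(D : ℝ)|) hlam hd₁ hKa hK2 ha hv hQ0 hid hA hB
      (le_trans (abs_nonneg _) (le_max_left _ _)) hH hGQ
    calc (max |(u : ℝ)| |(v : ℝ)|) ^ 2 ≤ (lamq q * |(v : ℝ)|) ^ 2 := by gcongr
      _ = lamq q ^ 2 * |(v : ℝ)| ^ 2 := by ring
      _ ≤ lamq q ^ 2 * (max 1 (Cb * lamq q ^ K * (2 * |(D : ℝ)| + 1)) * |((hform q.coeff 2 u v : ℤ) : ℝ)|) := by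
          gcongr
      _ = (lamq q ^ 2 * max 1 (Cb * lamq q ^ K * (2 * |(D : ℝ)| + 1))) * |((hform q.coeff 2 u v : ℤ) : ℝ)| := by
          ring
      _ ≤ heightC q Cb K D * |((hform q.coeff 2 u v : ℤ) : ℝ)| := by
          gcongr; exact le_max_right _ _

/-- **Level arithmetic.**  At a level `N` with `N! ≥ v₂(D) + a(c + E₀)`: `G = p_N κ`, `κ ≠ 0`, `|κ| ≤ |D||d|^a 2^{E₀}`,
`2^w ∣ Q`, `|Q| ≤ |d| 2^w`, `c ≤ w`, `a·w ≤ N! + E₀` (`2^{E₀} > |d|`, `d` the resultant datum). -/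
theorem level_arith {g q : ℤ[X]} {a : ℕ} {D : ℤ} (hq : q.natDegree = 2) (hnr : ∀ t : ℚ, aeval t q ≠ 0)
    (hga : g.natDegree ≤ 2 * a) (hD : D ≠ 0) (ha : 1 ≤ a) {d : ℤ} (hd : d ≠ 0)
    (hdiv : ∀ u v : ℤ, v ≠ 0 → IsCoprime u v →
      ∀ m : ℤ, m ∣ hform g.coeff (2 * a) u v → m ∣ hform q.coeff 2 u v → m ∣ d)
    {E₀ : ℕ} (hE₀ : |d| < 2 ^ E₀) {vD : ℕ} {D' : ℤ} (hDdec : D = 2 ^ vD * D') (hD' : ¬ (2 : ℤ) ∣ D')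
    {c N : ℕ} (hN2 : 2 ≤ N) (hNc : vD + a * (c + E₀) ≤ N !) {t : ℚ}
    (h : aeval t g = D * sQ N * (aeval t q) ^ a) :
    ∃ (κ : ℤ) (w : ℕ), hform g.coeff (2 * a) t.num t.den = psNumer 2 N * κ ∧ κ ≠ 0 ∧
      |κ| ≤ |D| * |d| ^ a * 2 ^ E₀ ∧ (2 : ℤ) ^ w ∣ hform q.coeff 2 t.num t.den ∧
      |hform q.coeff 2 t.num t.den| ≤ |d| * 2 ^ w ∧ c ≤ w ∧ a * w ≤ N ! + E₀ := by
  obtain ⟨κ, hκ, hκeq, hκ0, -⟩ := level_kappa hq hnr hga hD hN2 h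
  have hQ0 : hform q.coeff 2 t.num t.den ≠ 0 := Qform_ne_zero hq hnr t
  obtain ⟨w, m, hQwm, hmodd, hwmax⟩ := two_adic_decomp hQ0
  obtain ⟨vκ, κ', hκdec, hκ'odd, -⟩ := two_adic_decomp hκ0
  have hden : ((t.den : ℤ)) ≠ 0 := by exact_mod_cast t.den_nz
  have hcopr : IsCoprime t.num (t.den : ℤ) := isCoprime_num_den t
  have hm0 : m ≠ 0 := by rintro rfl; exact hQ0 (by rw [hQwm, mul_zero])
  -- the master identity `2^{N!} κ = D Q^a = 2^{vD + a w} (D' m^a)`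
  have hmaster : (2 : ℤ) ^ N ! * (2 ^ vκ * κ') = 2 ^ (vD + a * w) * (D' * m ^ a) := by
    rw [← hκdec, hκeq, hDdec, hQwm, mul_pow, ← pow_mul, pow_add]; ring
  have hoddR : ¬ (2 : ℤ) ∣ D' * m ^ a := by
    intro h2
    rcases Int.prime_two.dvd_mul.mp h2 with h2 | h2
    · exact hD' h2
    · exact hmodd (Int.prime_two.dvd_of_dvd_pow h2)
  -- (W0) `N! ≤ vD + a w`
  have hW0 : N ! ≤ vD + a * w := by
    apply le_of_pow_dvd_pow_mul_odd hoddR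
    rw [← hmaster]
    exact Dvd.intro _ rfl
  have hcw : c + E₀ ≤ w := by
    have : a * (c + E₀) ≤ a * w := by omega
    exact Nat.le_of_mul_le_mul_left this (by omega)
  -- (W3) `vκ < E₀`
  have hvκ : vκ < E₀ := by
    by_contra H
    have hE : E₀ ≤ vκ := le_of_not_gt H
    have h1 : (2 : ℤ) ^ E₀ ∣ hform g.coeff (2 * a) t.num t.den := by
      rw [hκ, hκdec]
      exact Dvd.dvd.mul_left (Dvd.dvd.mul_right (pow_dvd_pow 2 hE) _) _
    have h2 : (2 : ℤ) ^ E₀ ∣ hform q.coeff 2 t.num t.den := by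
      rw [hQwm]; exact Dvd.dvd.mul_right (pow_dvd_pow 2 (by omega)) _
    have h3 : (2 : ℤ) ^ E₀ ∣ d := hdiv t.num t.den hden hcopr _ h1 h2
    have h4 : (2 : ℤ) ^ E₀ ≤ |d| := Int.le_of_dvd (abs_pos.mpr hd) ((dvd_abs _ _).mpr h3)
    exact absurd hE₀ (not_lt.mpr h4)
  -- (W3') `a w ≤ N! + E₀`
  have hW3 : a * w ≤ N ! + E₀ := by
    have : vD + a * w ≤ N ! + vκ := by
      apply le_of_pow_dvd_pow_mul_odd hκ'odd
      refine ⟨D' * m ^ a, ?_⟩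
      rw [pow_add, mul_assoc, hmaster]
    omega
  -- `m ∣ d`, hence `|Q| ≤ |d| 2^w`
  have hmκ : m ∣ κ := by
    have h1 : m ∣ (2 : ℤ) ^ N ! * κ := by
      rw [hκeq, hQwm, mul_pow]; exact Dvd.dvd.mul_left (Dvd.dvd.mul_left (dvd_pow_self m (by omega : a ≠ 0)) _) _
    exact (isCoprime_two_pow_of_odd hmodd (N !)).symm.dvd_of_dvd_mul_left h1
  have hmd : m ∣ d := by
    refine hdiv t.num t.den hden hcopr m ?_ ?_
    · rw [hκ]; exact Dvd.dvd.mul_left hmκ _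
    · rw [hQwm]; exact Dvd.intro_left _ rfl
  have hmle : |m| ≤ |d| := Int.le_of_dvd (abs_pos.mpr hd) ((abs_dvd_abs _ _).mpr hmd)
  have hQle : |hform q.coeff 2 t.num t.den| ≤ |d| * 2 ^ w := by
    rw [hQwm, abs_mul, abs_pow, abs_two, mul_comm]
    gcongr
  -- `|κ| ≤ |D| |d|^a 2^{E₀}`
  have hκle : |κ| ≤ |D| * |d| ^ a * 2 ^ E₀ := by
    have h2pos : (0 : ℤ) < 2 ^ N ! := by positivity
    have h1 : (2 : ℤ) ^ N ! * |κ| = |D| * |hform q.coeff 2 t.num t.den| ^ a := by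
      rw [← abs_pow, ← abs_mul, ← hκeq, abs_mul, abs_pow, abs_two]
    have h2 : |hform q.coeff 2 t.num t.den| ^ a ≤ |d| ^ a * 2 ^ (a * w) := by
      calc |hform q.coeff 2 t.num t.den| ^ a ≤ (|d| * 2 ^ w) ^ a := by gcongr
        _ = |d| ^ a * 2 ^ (a * w) := by rw [mul_pow, ← pow_mul, mul_comm w a]
    have h3 : (2 : ℤ) ^ (a * w) ≤ 2 ^ N ! * 2 ^ E₀ := by
      rw [← pow_add]; exact pow_le_pow_right₀ (by norm_num) hW3
    have h4 : (2 : ℤ) ^ N ! * |κ| ≤ 2 ^ N ! * (|D| * |d| ^ a * 2 ^ E₀) := by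
      calc (2 : ℤ) ^ N ! * |κ| = |D| * |hform q.coeff 2 t.num t.den| ^ a := h1
        _ ≤ |D| * (|d| ^ a * 2 ^ (a * w)) := by gcongr
        _ ≤ |D| * (|d| ^ a * (2 ^ N ! * 2 ^ E₀)) := by gcongr
        _ = _ := by ring
    exact le_of_mul_le_mul_left h4 h2pos
  refine ⟨κ, w, hκ, hκ0, hκle, ?_, hQle, by omega, hW3⟩
  rw [hQwm]; exact Dvd.intro _ rfl

/-- **Level `2`-adic closeness.**  With `2^w ∣ Q(u,v)`, `w ≥ C_q`: one of the two linear forms `q₂u − θᵢv` is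
`2`-adically small, and then `v^{2a} ĝ(θᵢ)` is close to `q₂^{2a} κ`. -/
theorem level_padic {g q : ℤ[X]} {a : ℕ} {θ₁ θ₂ : PadicAlgCl 2}
    (hsum : θ₁ + θ₂ = -(q.coeff 1 : PadicAlgCl 2))
    (hprod : θ₁ * θ₂ = (q.coeff 0 : PadicAlgCl 2) * (q.coeff 2 : PadicAlgCl 2))
    (hne : θ₁ ≠ θ₂) (hθ₁ : ‖θ₁‖ ≤ 1) (hθ₂ : ‖θ₂‖ ≤ 1)
    {Cq : ℕ} (hCq : ¬ (2 : ℤ) ^ Cq ∣ q.coeff 2) {u v : ℤ} (huv : IsCoprime u v)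
    {w : ℕ} (hwQ : (2 : ℤ) ^ w ∣ hform q.coeff 2 u v) (hCw : Cq ≤ w)
    {κ : ℤ} {N : ℕ} (hN : 1 ≤ N) (hG : hform g.coeff (2 * a) u v = psNumer 2 N * κ) :
    ∃ θ : PadicAlgCl 2, (θ = θ₁ ∨ θ = θ₂) ∧
      ‖(q.coeff 2 : PadicAlgCl 2) * u - θ * v‖ ≤ (1 / 2 : ℝ) ^ w / (‖θ₁ - θ₂‖ * (1 / 2 : ℝ) ^ Cq) ∧
      ‖(v : PadicAlgCl 2) ^ (2 * a) * hform (ghatc g q a) (2 * a) θ 1 - (q.coeff 2 : PadicAlgCl 2) ^ (2 * a) * κ‖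
        ≤ (1 / 2 : ℝ) ^ w / (‖θ₁ - θ₂‖ * (1 / 2 : ℝ) ^ Cq) + (1 / 2 : ℝ) ^ (Nat.factorial N - Nat.factorial (N - 1)) := by
  set δ : ℝ := ‖θ₁ - θ₂‖ * (1 / 2 : ℝ) ^ Cq with hδ
  have h12 : 0 < ‖θ₁ - θ₂‖ := norm_pos_iff.mpr (sub_ne_zero.mpr hne)
  have hδpos : 0 < δ := by positivity
  -- `‖v‖ > (1/2)^{Cq}`
  have hvn : (1 / 2 : ℝ) ^ Cq < ‖(v : PadicAlgCl 2)‖ :=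
    normK_intCast_gt_of_not_dvd (not_pow_dvd_den huv hCq ((pow_dvd_pow 2 hCw).trans hwQ))
  -- the two factors
  set A₁ : PadicAlgCl 2 := (q.coeff 2 : PadicAlgCl 2) * u - θ₁ * v with hA₁
  set A₂ : PadicAlgCl 2 := (q.coeff 2 : PadicAlgCl 2) * u - θ₂ * v with hA₂
  have hsep : δ ≤ ‖A₂ - A₁‖ := by
    have : A₂ - A₁ = (θ₁ - θ₂) * v := by rw [hA₁, hA₂]; ring
    rw [this, norm_mul, hδ]
    gcongr
  have hsmall : ‖A₁ * A₂‖ ≤ (1 / 2 : ℝ) ^ w := by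
    have hf := quadForm_factor (q := q) hsum hprod u v
    rw [← hA₁, ← hA₂] at hf
    rw [← hf, ← Int.cast_mul]
    exact normK_intCast_le_of_dvd (Dvd.dvd.mul_left hwQ _)
  -- norms ≤ 1
  have hxu : ‖(q.coeff 2 : PadicAlgCl 2) * u‖ ≤ 1 := by
    rw [← Int.cast_mul]; exact normK_intCast_le_one _
  have hv1 : ‖(v : PadicAlgCl 2)‖ ≤ 1 := normK_intCast_le_one v
  -- the `p_N − 1` term
  have hpN : ‖(q.coeff 2 : PadicAlgCl 2) ^ (2 * a) * ((psNumer 2 N : ℤ) : PadicAlgCl 2) * κ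
      - (q.coeff 2 : PadicAlgCl 2) ^ (2 * a) * κ‖ ≤ (1 / 2 : ℝ) ^ (Nat.factorial N - Nat.factorial (N - 1)) := by
    have : (q.coeff 2 : PadicAlgCl 2) ^ (2 * a) * ((psNumer 2 N : ℤ) : PadicAlgCl 2) * κ
        - (q.coeff 2 : PadicAlgCl 2) ^ (2 * a) * κ
        = ((q.coeff 2 : PadicAlgCl 2) ^ (2 * a) * κ) * ((psNumer 2 N : PadicAlgCl 2) - 1) := by push_cast; ring
    rw [this, norm_mul]
    calc ‖(q.coeff 2 : PadicAlgCl 2) ^ (2 * a) * κ‖ * ‖(psNumer 2 N : PadicAlgCl 2) - 1‖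
        ≤ 1 * (1 / 2 : ℝ) ^ (Nat.factorial N - Nat.factorial (N - 1)) := by
          gcongr
          · rw [← Int.cast_pow, ← Int.cast_mul]; exact normK_intCast_le_one _
          · exact norm_psNumer_sub_one hN
      _ = _ := one_mul _
  -- the form identity at `(q₂u, v)`
  have hformG : hform (ghatc g q a) (2 * a) ((q.coeff 2 : PadicAlgCl 2) * u) v
      = (q.coeff 2 : PadicAlgCl 2) ^ (2 * a) * ((psNumer 2 N : ℤ) : PadicAlgCl 2) * κ := by
    have hs := hform_scale g.coeff (2 * a) (q.coeff 2) (u : PadicAlgCl 2) (v : PadicAlgCl 2)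
    change (q.coeff 2 : PadicAlgCl 2) ^ (2 * a) * hform g.coeff (2 * a) (u : PadicAlgCl 2) (v : PadicAlgCl 2)
      = hform (ghatc g q a) (2 * a) ((q.coeff 2 : PadicAlgCl 2) * u) v at hs
    rw [← hs, ← hform_intCast, hG]; push_cast; ring
  -- choose the small factor
  rcases factor_small A₁ A₂ hδpos hsep hsmall with h | h
  · refine ⟨θ₁, Or.inl rfl, h, ?_⟩
    have hy : ‖θ₁ * v‖ ≤ 1 := by rw [norm_mul]; exact mul_le_one₀ hθ₁ (norm_nonneg _) hv1
    have hL := hform_lipschitz (ghatc g q a) (2 * a) _ _ _ hxu hy hv1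
    rw [hformG, hform_mul_left] at hL
    calc _ = ‖((v : PadicAlgCl 2) ^ (2 * a) * hform (ghatc g q a) (2 * a) θ₁ 1
              - (q.coeff 2 : PadicAlgCl 2) ^ (2 * a) * ((psNumer 2 N : ℤ) : PadicAlgCl 2) * κ)
            + ((q.coeff 2 : PadicAlgCl 2) ^ (2 * a) * ((psNumer 2 N : ℤ) : PadicAlgCl 2) * κ
              - (q.coeff 2 : PadicAlgCl 2) ^ (2 * a) * κ)‖ := by congr 1; ring
      _ ≤ ‖(v : PadicAlgCl 2) ^ (2 * a) * hform (ghatc g q a) (2 * a) θ₁ 1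
              - (q.coeff 2 : PadicAlgCl 2) ^ (2 * a) * ((psNumer 2 N : ℤ) : PadicAlgCl 2) * κ‖
            + ‖(q.coeff 2 : PadicAlgCl 2) ^ (2 * a) * ((psNumer 2 N : ℤ) : PadicAlgCl 2) * κ
              - (q.coeff 2 : PadicAlgCl 2) ^ (2 * a) * κ‖ := norm_add_le _ _
      _ ≤ (1 / 2 : ℝ) ^ w / δ + (1 / 2 : ℝ) ^ (Nat.factorial N - Nat.factorial (N - 1)) := by
            gcongr
            · rw [norm_sub_rev]; exact hL.trans h
  · refine ⟨θ₂, Or.inr rfl, h, ?_⟩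
    have hy : ‖θ₂ * v‖ ≤ 1 := by rw [norm_mul]; exact mul_le_one₀ hθ₂ (norm_nonneg _) hv1
    have hL := hform_lipschitz (ghatc g q a) (2 * a) _ _ _ hxu hy hv1
    rw [hformG, hform_mul_left] at hL
    calc _ = ‖((v : PadicAlgCl 2) ^ (2 * a) * hform (ghatc g q a) (2 * a) θ₂ 1
              - (q.coeff 2 : PadicAlgCl 2) ^ (2 * a) * ((psNumer 2 N : ℤ) : PadicAlgCl 2) * κ)
            + ((q.coeff 2 : PadicAlgCl 2) ^ (2 * a) * ((psNumer 2 N : ℤ) : PadicAlgCl 2) * κ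
              - (q.coeff 2 : PadicAlgCl 2) ^ (2 * a) * κ)‖ := by congr 1; ring
      _ ≤ ‖(v : PadicAlgCl 2) ^ (2 * a) * hform (ghatc g q a) (2 * a) θ₂ 1
              - (q.coeff 2 : PadicAlgCl 2) ^ (2 * a) * ((psNumer 2 N : ℤ) : PadicAlgCl 2) * κ‖
            + ‖(q.coeff 2 : PadicAlgCl 2) ^ (2 * a) * ((psNumer 2 N : ℤ) : PadicAlgCl 2) * κ
              - (q.coeff 2 : PadicAlgCl 2) ^ (2 * a) * κ‖ := norm_add_le _ _
      _ ≤ (1 / 2 : ℝ) ^ w / δ + (1 / 2 : ℝ) ^ (Nat.factorial N - Nat.factorial (N - 1)) := by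
            gcongr
            · rw [norm_sub_rev]; exact hL.trans h

end SplitGrades

end Summit.Schanuel.Schanuel.Theorems.RootDecomp1KLevelFinite

end
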